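import Summits.QuantumFields.BalabanUV.T4Continuum.E3Cert.ZL2d4C0half.Data
/-! E3 certificate package `ZL2d4C0half` — module `S12` ((4,2,1) block, d = 4, L = 2, type A small-field hypothesis c₀ = ½ ((x_t)₀ ≥ ½ on every link), γ = 923∕1024, M = 2²¹; emitter `bal_e3_lean_emit.py` output for
`block-L2d4-su2-c0half-dyadic.json`, lane `run/shared/lean/ttrl/balaban-calc/e3/lean-draft/tree/zL2d4C0half/S12.lean`; TREE COPY by the substrate cell (seat p3), typer
rulings (μ3)∕(ν2) = FINAL (μ6), journal l.19196 ∕ l.20020, following the E3 PILOT's scripted road (`substrate/p3/E3-PILOT.md` §1): import prefix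
substituted and one-line docstrings added BY SCRIPT, no literal touched).  Meaning of the certificate: see `Data.lean` ∕ `Main.lean` of this package
and the checker `E3Cert/E3PolyCertZ*.lean`.  HONEST: certified computation on ONE small block — NOT Prop. (1.8), NOT an input of any NE row today,
NOT infinite volume ∕ mass gap ∕ Clay. -/
set_option maxRecDepth 200000
set_option maxHeartbeats 0
namespace E3Z
/-- E3 certificate `zL2d4C0half` component: `zL2d4C0half_inq13` (lane output, transcribed verbatim; see the module docstring). -/
theorem zL2d4C0half_inq13 : (GramCert.blockCert zL2d4C0half.nx zL2d4C0half.basis (zL2d4C0half.ineq.getD 13 ([], ⟨[], 0, [], 0, []⟩, 0)).2.1).check = true := by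
  decide +kernel
/-- E3 certificate `zL2d4C0half` component: `zL2d4C0half_inq14` (lane output, transcribed verbatim; see the module docstring). -/
theorem zL2d4C0half_inq14 : (GramCert.blockCert zL2d4C0half.nx zL2d4C0half.basis (zL2d4C0half.ineq.getD 14 ([], ⟨[], 0, [], 0, []⟩, 0)).2.1).check = true := by
  decide +kernel
/-- E3 certificate `zL2d4C0half` component: `zL2d4C0half_inq15` (lane output, transcribed verbatim; see the module docstring). -/
theorem zL2d4C0half_inq15 : (GramCert.blockCert zL2d4C0half.nx zL2d4C0half.basis (zL2d4C0half.ineq.getD 15 ([], ⟨[], 0, [], 0, []⟩, 0)).2.1).check = true := by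
  decide +kernel
/-- E3 certificate `zL2d4C0half` component: `zL2d4C0half_inq16` (lane output, transcribed verbatim; see the module docstring). -/
theorem zL2d4C0half_inq16 : (GramCert.blockCert zL2d4C0half.nx zL2d4C0half.basis (zL2d4C0half.ineq.getD 16 ([], ⟨[], 0, [], 0, []⟩, 0)).2.1).check = true := by
  decide +kernel
/-- E3 certificate `zL2d4C0half` component: `zL2d4C0half_eq0` (lane output, transcribed verbatim; see the module docstring). -/
theorem zL2d4C0half_eq0 : GramCert.eqCheck (zL2d4C0half.eq.getD 0 ([], [], [])) = true := by
  decide +kernel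
/-- E3 certificate `zL2d4C0half` component: `zL2d4C0half_eq1` (lane output, transcribed verbatim; see the module docstring). -/
theorem zL2d4C0half_eq1 : GramCert.eqCheck (zL2d4C0half.eq.getD 1 ([], [], [])) = true := by
  decide +kernel
/-- E3 certificate `zL2d4C0half` component: `zL2d4C0half_eq2` (lane output, transcribed verbatim; see the module docstring). -/
theorem zL2d4C0half_eq2 : GramCert.eqCheck (zL2d4C0half.eq.getD 2 ([], [], [])) = true := by
  decide +kernel
/-- E3 certificate `zL2d4C0half` component: `zL2d4C0half_eq3` (lane output, transcribed verbatim; see the module docstring). -/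
theorem zL2d4C0half_eq3 : GramCert.eqCheck (zL2d4C0half.eq.getD 3 ([], [], [])) = true := by
  decide +kernel
end E3Z
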